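import Mathlib
import HarnessLib

/-!
# Friedlander–Iwaniec, *The polynomial `X² + Y⁴` captures its primes*, Lemma 9.1: pairs of roots of `a γ₁² ≡ b γ₂² (mod q)`

Family `parity`, statement parity.S17. Source: J. Friedlander, H. Iwaniec, Ann. of Math. (2) 148
(1998), 945–1040 [FriedlanderIwaniecAnnals1998], §9, (9.8)–(9.9), Lemma 9.1: "`N(a, b; q)`
denotes the number of solutions `γ₁, γ₂` to (9.8) `a γ₁² ≡ b γ₂² (mod q)` … LEMMA 9.1. For any
integers `a, b, q` with `q ≥ 1` we have (9.9) `N(a, b; q) ≤ ([a, b], q) q τ(q)`. Proof. By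
multiplicativity we can assume that `q` is a prime power …".

This count controls two averages of divisor-type functions over the values of binary forms in
the paper: in the proof of Lemma 5.1 (the number of `c₁, c₂` with `c₁² s₂* ≡ c₂² s₁* (mod d)`) and
in §9 ((9.7), the sum `L(r₁, r₂)`). Everything here is PROVED. We prove the cruder bound

  `N(a, b; q) ≤ τ(q)³ · q · (ab, q)`      (`quadCongrCount_le`)

(`(ab, q) ≥ ([a, b], q)`, and `τ(q)³` in place of `τ(q)`), which is what the crude-logarithm
versions of Lemma 5.1 and of (9.10) in this series consume: at a prime power `p^k` we show
`N(a, b; p^k) ≤ 4(k+1) p^k (ab, p^k)` by fibring over `γ₂` and counting square roots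
(`card_filter_sq_congr_le`: `#{x mod p^k : a x² ≡ m} ≤ 4 p^{⌊v_p(m)/2⌋}` for `p ∤ a`), and the
Chinese remainder theorem multiplies the local bounds (`quadCongrCount_mul_le`).

## Contents

* `card_filter_range_mul` — a `D`-periodic predicate has `n · #{x < D : P x}` solutions below
  `D n`; `card_filter_range_dvd` — `#{x < Q : d ∣ x} = Q/d` for `d ∣ Q`;
* `card_filter_unitSq_le_four` — `#{x mod p^k : a x² ≡ m} ≤ 4` for `p ∤ m`;
* `pow_dvd_of_pow_dvd_sq` — `p^k ∣ x² ⇒ p^{⌈k/2⌉} ∣ x`; `card_filter_sq_congr_le` —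
  `#{x mod p^k : a x² ≡ m} ≤ 4 p^{⌊e/2⌋}` for `p ∤ a`, `p^e ∣ m`, `e ≤ k`, `e = k ∨ p^{e+1} ∤ m`;
* `quadCongrCount q a b = N(a, b; q)` (`_def`, `_le_sq`, `_eq_sum`), `gcd_prime_pow_eq`,
  `sum_range_powWeight_eq`, `card_fibre_le` (the fibre over `y`),
  `quadCongrCount_prime_pow_le` (`N(a, b; p^k) ≤ 4(k+1) p^k (ab, p^k)`), `quadCongrCount_mul_le`
  (CRT), `quadCongrCount_le` (the displayed bound).

## References

* J. Friedlander, H. Iwaniec, Ann. of Math. (2) 148 (1998), 945–1040, Lemma 9.1.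
  [FriedlanderIwaniecAnnals1998]

## Mathlib

`padicValNat`, `padicValInt`, `padicValNat_dvd_iff_le`, `Finset.range_add`,
`Nat.modEq_and_modEq_iff_modEq_mul`, `Nat.Coprime.gcd_mul`, `Nat.Coprime.card_divisors_mul`,
`Nat.recOnPosPrimePosCoprime`.
-/

open Finset

namespace Literature.NumberTheory.Sieve.FriedlanderIwaniecPrimes

/-! ### Counting with periodic predicates -/

/-- A `D`-periodic predicate has exactly `n · #{x < D : P x}` solutions `x < D n`. [folklore] -/
theorem card_filter_range_mul (D n : ℕ) (P : ℕ → Prop) [DecidablePred P]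
    (hP : ∀ x, P (x + D) ↔ P x) :
    #((range (D * n)).filter P) = n * #((range D).filter P) := by
  have hPm : ∀ m x, P (D * m + x) ↔ P x := by
    intro m
    induction m with
    | zero => intro x; simp
    | succ m ih =>
      intro x
      rw [Nat.mul_succ, show D * m + D + x = (D * m + x) + D by ring, hP, ih]
  induction n with
  | zero => simp
  | succ n ih =>
    rw [Nat.mul_succ, Finset.range_add, filter_union, card_union_of_disjoint, ih, filter_map,
      card_map, add_mul, one_mul]
    · congr 1
      congr 1
      refine filter_congr fun x _ => ?_
      simp only [Function.comp_apply, addLeftEmbedding_apply]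
      exact hPm n x
    · exact (disjoint_range_addLeftEmbedding _ _).mono (filter_subset _ _) (filter_subset _ _)

/-- Multiples of `d ∣ Q` below `Q`: exactly `Q / d`. [folklore] -/
theorem card_filter_range_dvd {d Q : ℕ} (hd : 0 < d) (hdQ : d ∣ Q) :
    #((range Q).filter fun x => d ∣ x) = Q / d := by
  obtain ⟨n, rfl⟩ := hdQ
  rw [card_filter_range_mul d n (fun x => d ∣ x) fun x => by simp, Nat.mul_div_cancel_left _ hd]
  have : (range d).filter (fun x => d ∣ x) = {0} := by
    ext x
    simp only [mem_filter, mem_range, mem_singleton]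
    constructor
    · rintro ⟨hx, hdx⟩
      exact Nat.eq_zero_of_dvd_of_lt hdx hx
    · rintro rfl; exact ⟨hd, dvd_zero d⟩
  rw [this, card_singleton, mul_one]

/-! ### Square roots modulo prime powers -/

/-- For a prime `p` and `m` prime to `p`, the congruence `a x² ≡ m (mod p^k)` has at most four
solutions `x (mod p^k)`: two solutions differ by a factor `±1` modulo `p^k` (`p` odd) or modulo
`2^{k-1}` (`p = 2`). [folklore] -/
theorem card_filter_unitSq_le_four {p : ℕ} (hp : p.Prime) (k : ℕ) (a : ℤ) {m : ℤ}
    (hm : ¬ (p : ℤ) ∣ m) :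
    #((range (p ^ k)).filter fun x : ℕ => (p : ℤ) ^ k ∣ a * (x : ℤ) ^ 2 - m) ≤ 4 := by
  set S := (range (p ^ k)).filter fun x : ℕ => (p : ℤ) ^ k ∣ a * (x : ℤ) ^ 2 - m with hS
  rcases S.eq_empty_or_nonempty with hSe | ⟨x₀, hx₀⟩
  · rw [hSe]; simp
  rcases Nat.eq_zero_or_pos k with hk | hk
  · -- modulus 1: the range has one element
    calc #S ≤ #(range (p ^ k)) := card_le_card (filter_subset _ _)
      _ = 1 := by rw [card_range, hk, pow_zero]
      _ ≤ 4 := by norm_num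
  set q : ℤ := (p : ℤ) ^ k with hq
  have hq0 : 0 < q := pow_pos (by exact_mod_cast hp.pos) _
  have hpq : (p : ℤ) ∣ q := dvd_pow_self _ hk.ne'
  have hpp : Prime (p : ℤ) := Nat.prime_iff_prime_int.mp hp
  obtain ⟨hx₀r, hx₀d⟩ := mem_filter.mp hx₀
  -- `p ∤ a` and `p ∤ x₀`
  have hx₀p : ¬ (p : ℤ) ∣ (x₀ : ℤ) := by
    intro h
    apply hm
    have h1 : (p : ℤ) ∣ a * (x₀ : ℤ) ^ 2 := (dvd_pow h two_ne_zero).mul_left a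
    have h2 : (p : ℤ) ∣ a * (x₀ : ℤ) ^ 2 - m := hpq.trans hx₀d
    have := dvd_sub h1 h2
    simpa using this
  -- the candidate set
  set h : ℤ := q / 2 with hh
  set T : Finset ℤ := {(x₀ : ℤ), -(x₀ : ℤ), (x₀ : ℤ) + h, -(x₀ : ℤ) + h} with hT
  have hTcard : #T ≤ 4 := by
    rw [hT]
    refine (card_insert_le _ _).trans ?_
    refine (Nat.succ_le_succ (card_insert_le _ _)).trans ?_
    refine (Nat.succ_le_succ (Nat.succ_le_succ (card_insert_le _ _))).trans ?_
    rw [card_singleton]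
  -- every solution is congruent to a candidate
  have key : ∀ x ∈ S, ∃ t ∈ T, q ∣ (x : ℤ) - t := by
    intro x hx
    obtain ⟨hxr, hxd⟩ := mem_filter.mp hx
    have hprod : q ∣ a * (((x : ℤ) - x₀) * ((x : ℤ) + x₀)) := by
      have := dvd_sub hxd hx₀d
      have e : a * (x : ℤ) ^ 2 - m - (a * (x₀ : ℤ) ^ 2 - m) = a * (((x : ℤ) - x₀) * ((x : ℤ) + x₀)) := by
        ring
      rwa [e] at this
    have hap : ¬ (p : ℤ) ∣ a := by
      intro h
      apply hm
      have h1 : (p : ℤ) ∣ a * (x₀ : ℤ) ^ 2 := h.mul_right _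
      have h2 : (p : ℤ) ∣ a * (x₀ : ℤ) ^ 2 - m := hpq.trans hx₀d
      simpa using dvd_sub h1 h2
    have hcopa : IsCoprime q a := by
      rw [hq]; exact IsCoprime.pow_left ((Prime.coprime_iff_not_dvd hpp).mpr hap)
    have hprod' : q ∣ ((x : ℤ) - x₀) * ((x : ℤ) + x₀) := hcopa.dvd_of_dvd_mul_left hprod
    by_cases hp2 : p = 2
    · -- p = 2: x, x₀ odd
      subst hp2
      have hx₀odd : ¬ (2 : ℤ) ∣ (x₀ : ℤ) := by exact_mod_cast hx₀p
      have hxodd : ¬ (2 : ℤ) ∣ (x : ℤ) := by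
        intro h2x
        apply hm
        have h1 : ((2 : ℕ) : ℤ) ∣ a * (x : ℤ) ^ 2 := (dvd_pow h2x two_ne_zero).mul_left a
        have h2 : ((2 : ℕ) : ℤ) ∣ a * (x : ℤ) ^ 2 - m := hpq.trans hxd
        simpa using dvd_sub h1 h2
      obtain ⟨k', rfl⟩ : ∃ k', k = k' + 1 := ⟨k - 1, by omega⟩
      have hqh : q = 2 * h := by
        rw [hh, hq]; push_cast; rw [pow_succ]; omega
      have hh' : h = (2 : ℤ) ^ k' := by
        rw [hh, hq]; push_cast; rw [pow_succ]; omega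
      -- one of x - x₀, x + x₀ is ≡ 2 mod 4
      have hsum : ¬ ((4 : ℤ) ∣ (x : ℤ) - x₀ ∧ (4 : ℤ) ∣ (x : ℤ) + x₀) := by
        rintro ⟨h1, h2⟩
        have : (4 : ℤ) ∣ 2 * (x : ℤ) := by
          have := dvd_add h1 h2; rwa [show (x : ℤ) - x₀ + ((x : ℤ) + x₀) = 2 * x by ring] at this
        omega
      have hev1 : (2 : ℤ) ∣ (x : ℤ) - x₀ := by omega
      have hev2 : (2 : ℤ) ∣ (x : ℤ) + x₀ := by omega
      -- if 4 ∤ d₁ then h ∣ d₂, and conversely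
      have step : ∀ d₁ d₂ : ℤ, q ∣ d₁ * d₂ → (2 : ℤ) ∣ d₁ → ¬ (4 : ℤ) ∣ d₁ → h ∣ d₂ := by
        intro d₁ d₂ hqd hd2 hd4
        obtain ⟨d₁', rfl⟩ := hd2
        have hodd : ¬ (2 : ℤ) ∣ d₁' := by
          intro h2; apply hd4; obtain ⟨e, rfl⟩ := h2; exact ⟨e, by ring⟩
        rw [hqh, mul_assoc] at hqd
        have h2 : h ∣ d₁' * d₂ := (mul_dvd_mul_iff_left two_ne_zero).mp hqd
        have hcop : IsCoprime h d₁' := by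
          rw [hh']
          exact IsCoprime.pow_left ((Prime.coprime_iff_not_dvd Int.prime_two).mpr hodd)
        exact hcop.dvd_of_dvd_mul_left h2
      -- from h ∣ d, d is ≡ 0 or h mod q = 2h
      have lift : ∀ d : ℤ, h ∣ d → q ∣ d ∨ q ∣ d - h := by
        intro d hd
        obtain ⟨t, rfl⟩ := hd
        rcases Int.even_or_odd t with ⟨s, rfl⟩ | ⟨s, rfl⟩
        · left; rw [hqh]; exact ⟨s, by ring⟩
        · right; rw [hqh]; exact ⟨s, by ring⟩
      by_cases h4 : (4 : ℤ) ∣ (x : ℤ) - x₀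
      · have h4' : ¬ (4 : ℤ) ∣ (x : ℤ) + x₀ := fun h' => hsum ⟨h4, h'⟩
        have hd : h ∣ (x : ℤ) - x₀ :=
          step _ _ (by rwa [mul_comm] at hprod') hev2 h4'
        rcases lift _ hd with h1 | h1
        · exact ⟨x₀, by simp [hT], h1⟩
        · exact ⟨(x₀ : ℤ) + h, by simp [hT], by rwa [show (x : ℤ) - (x₀ + h) = (x : ℤ) - x₀ - h by ring]⟩
      · have hd : h ∣ (x : ℤ) + x₀ := step _ _ hprod' hev1 h4
        rcases lift _ hd with h1 | h1
        · exact ⟨-(x₀ : ℤ), by simp [hT], by rwa [show (x : ℤ) - -(x₀ : ℤ) = (x : ℤ) + x₀ by ring]⟩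
        · exact ⟨-(x₀ : ℤ) + h, by simp [hT], by
            rwa [show (x : ℤ) - (-(x₀ : ℤ) + h) = (x : ℤ) + x₀ - h by ring]⟩
    · -- p odd: p^k divides one of the two factors
      have hnot : ¬ ((p : ℤ) ∣ (x : ℤ) - x₀ ∧ (p : ℤ) ∣ (x : ℤ) + x₀) := by
        rintro ⟨h1, h2⟩
        have h3 : (p : ℤ) ∣ 2 * (x₀ : ℤ) := by
          have := dvd_sub h2 h1
          rwa [show (x : ℤ) + x₀ - ((x : ℤ) - x₀) = 2 * x₀ by ring] at this
        rcases hpp.dvd_or_dvd h3 with h4 | h4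
        · have : (p : ℤ) ≤ 2 := Int.le_of_dvd (by norm_num) h4
          have h2le : p ≤ 2 := by exact_mod_cast this
          exact hp2 (le_antisymm h2le hp.two_le)
        · exact hx₀p h4
      have hcop_of : ∀ d : ℤ, ¬ (p : ℤ) ∣ d → IsCoprime q d := by
        intro d hd
        rw [hq]
        exact IsCoprime.pow_left ((Prime.coprime_iff_not_dvd hpp).mpr hd)
      by_cases h1 : (p : ℤ) ∣ (x : ℤ) - x₀
      · have h2 : ¬ (p : ℤ) ∣ (x : ℤ) + x₀ := fun h' => hnot ⟨h1, h'⟩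
        have : q ∣ (x : ℤ) - x₀ := (hcop_of _ h2).dvd_of_dvd_mul_right hprod'
        exact ⟨x₀, by simp [hT], this⟩
      · have : q ∣ (x : ℤ) + x₀ := (hcop_of _ h1).dvd_of_dvd_mul_left hprod'
        exact ⟨-(x₀ : ℤ), by simp [hT], by rwa [show (x : ℤ) - -(x₀ : ℤ) = (x : ℤ) + x₀ by ring]⟩
  -- conclude: S injects into T through x ↦ its class
  have hsub : S ⊆ T.image fun t : ℤ => (t % q).toNat := by
    intro x hx
    obtain ⟨t, ht, hqt⟩ := key x hx
    obtain ⟨hxr, -⟩ := mem_filter.mp hx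
    refine mem_image.mpr ⟨t, ht, ?_⟩
    have hxq : (x : ℤ) < q := by rw [hq]; exact_mod_cast mem_range.mp hxr
    have hmod : t % q = (x : ℤ) % q := Int.modEq_iff_dvd.mpr hqt
    rw [hmod, Int.emod_eq_of_lt (by positivity) hxq, Int.toNat_natCast]
  calc #S ≤ #(T.image fun t : ℤ => (t % q).toNat) := card_le_card hsub
    _ ≤ #T := card_image_le
    _ ≤ 4 := hTcard

/-- `p^k ∣ x²` forces `p^{⌈k/2⌉} ∣ x`. [folklore] -/
theorem pow_dvd_of_pow_dvd_sq {p : ℕ} (hp : p.Prime) {k x : ℕ} (h : p ^ k ∣ x ^ 2) :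
    p ^ ((k + 1) / 2) ∣ x := by
  haveI := Fact.mk hp
  rcases eq_or_ne x 0 with rfl | hx
  · exact dvd_zero _
  have hx2 : x ^ 2 ≠ 0 := pow_ne_zero 2 hx
  rw [padicValNat_dvd_iff_le hx2, padicValNat.pow] at h
  rw [padicValNat_dvd_iff_le hx]
  omega

/-- Square roots of a general residue: for `p ∤ a`, `p^e ∣ m` with `e ≤ k` and (`e = k` or
`p^{e+1} ∤ m`), the congruence `a x² ≡ m (mod p^k)` has at most `4 p^{⌊e/2⌋}` solutions `x (mod p^k)`
(none unless `e` is even or `e = k`; for even `e = 2e'` the solutions are `p^{e'} x'` with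
`a x'² ≡ m/p^e (mod p^{k-e})`). [folklore] -/
theorem card_filter_sq_congr_le {p : ℕ} (hp : p.Prime) {k e : ℕ} (hek : e ≤ k) {a m : ℤ}
    (ha : ¬ (p : ℤ) ∣ a) (hm : (p : ℤ) ^ e ∣ m) (hmax : e = k ∨ ¬ (p : ℤ) ^ (e + 1) ∣ m) :
    #((range (p ^ k)).filter fun x : ℕ => (p : ℤ) ^ k ∣ a * (x : ℤ) ^ 2 - m) ≤ 4 * p ^ (e / 2) := by
  have hpp : Prime (p : ℤ) := Nat.prime_iff_prime_int.mp hp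
  have hp0 : (p : ℤ) ≠ 0 := by exact_mod_cast hp.ne_zero
  have hcop : ∀ j : ℕ, IsCoprime ((p : ℤ) ^ j) a := fun j =>
    IsCoprime.pow_left ((Prime.coprime_iff_not_dvd hpp).mpr ha)
  -- any solution has `p^e ∣ x²` (in `ℕ`)
  have hsol : ∀ x : ℕ, (p : ℤ) ^ k ∣ a * (x : ℤ) ^ 2 - m → p ^ e ∣ x ^ 2 := by
    intro x hx
    have h1 : (p : ℤ) ^ e ∣ a * (x : ℤ) ^ 2 - m := (pow_dvd_pow _ hek).trans hx
    have h2 : (p : ℤ) ^ e ∣ a * (x : ℤ) ^ 2 := by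
      have := dvd_add h1 hm; rwa [sub_add_cancel] at this
    have h3 : (p : ℤ) ^ e ∣ (x : ℤ) ^ 2 := (hcop e).dvd_of_dvd_mul_left h2
    exact_mod_cast h3
  rcases eq_or_lt_of_le hek with rfl | hek'
  · -- `e = k`: the solutions are among the multiples of `p^{⌈e/2⌉}`
    calc #((range (p ^ e)).filter fun x : ℕ => (p : ℤ) ^ e ∣ a * (x : ℤ) ^ 2 - m)
        ≤ #((range (p ^ e)).filter fun x : ℕ => p ^ ((e + 1) / 2) ∣ x) := by
          refine card_le_card fun x hx => ?_
          rw [mem_filter] at hx ⊢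
          exact ⟨hx.1, pow_dvd_of_pow_dvd_sq hp (hsol x hx.2)⟩
      _ = p ^ e / p ^ ((e + 1) / 2) :=
          card_filter_range_dvd (pow_pos hp.pos _) (pow_dvd_pow _ (by omega))
      _ = p ^ (e / 2) := by
          rw [Nat.pow_div (by omega) hp.pos]; congr 1; omega
      _ ≤ 4 * p ^ (e / 2) := Nat.le_mul_of_pos_left _ (by norm_num)
  · have hmax' : ¬ (p : ℤ) ^ (e + 1) ∣ m := hmax.resolve_left hek'.ne
    rcases Nat.even_or_odd e with ⟨e', he'⟩ | hodd
    · -- `e = e' + e'`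
      obtain ⟨m', rfl⟩ := hm
      have hm'p : ¬ (p : ℤ) ∣ m' := by
        intro h; apply hmax'; rw [pow_succ]; exact mul_dvd_mul_left _ h
      set S' := (range (p ^ (k - e'))).filter
        fun x' : ℕ => (p : ℤ) ^ (k - e) ∣ a * (x' : ℤ) ^ 2 - m' with hS'
      have hsub : ((range (p ^ k)).filter
          fun x : ℕ => (p : ℤ) ^ k ∣ a * (x : ℤ) ^ 2 - (p : ℤ) ^ e * m') ⊆
          S'.image fun x' => p ^ e' * x' := by
        intro x hx
        rw [mem_filter, mem_range] at hx
        have hdvd : p ^ e' ∣ x := by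
          refine (pow_dvd_pow _ ?_).trans (pow_dvd_of_pow_dvd_sq hp (hsol x hx.2))
          omega
        obtain ⟨x', rfl⟩ := hdvd
        refine mem_image.mpr ⟨x', mem_filter.mpr ⟨mem_range.mpr ?_, ?_⟩, rfl⟩
        · have : p ^ e' * x' < p ^ e' * p ^ (k - e') := by
            rw [← pow_add, show e' + (k - e') = k by omega]; exact hx.1
          exact Nat.lt_of_mul_lt_mul_left this
        · have h := hx.2
          have hx2 : a * ((p ^ e' * x' : ℕ) : ℤ) ^ 2 - (p : ℤ) ^ e * m' =
              (p : ℤ) ^ e * (a * (x' : ℤ) ^ 2 - m') := by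
            push_cast
            rw [he', pow_add]
            ring
          rw [hx2, show (p : ℤ) ^ k = (p : ℤ) ^ e * (p : ℤ) ^ (k - e) by
            rw [← pow_add]; congr 1; omega] at h
          exact (mul_dvd_mul_iff_left (pow_ne_zero e hp0)).mp h
      have hper : ∀ x' : ℕ, ((p : ℤ) ^ (k - e) ∣ a * ((x' + p ^ (k - e) : ℕ) : ℤ) ^ 2 - m') ↔
          ((p : ℤ) ^ (k - e) ∣ a * (x' : ℤ) ^ 2 - m') := by
        intro x'
        have : a * ((x' + p ^ (k - e) : ℕ) : ℤ) ^ 2 - m' =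
            (a * (x' : ℤ) ^ 2 - m') + (p : ℤ) ^ (k - e) * (a * (2 * x' + p ^ (k - e))) := by
          push_cast; ring
        rw [this]
        constructor
        · intro h1
          have := dvd_sub h1 (dvd_mul_right ((p : ℤ) ^ (k - e)) (a * (2 * x' + p ^ (k - e))))
          rwa [add_sub_cancel_right] at this
        · intro h1; exact dvd_add h1 (dvd_mul_right _ _)
      calc #((range (p ^ k)).filter
            fun x : ℕ => (p : ℤ) ^ k ∣ a * (x : ℤ) ^ 2 - (p : ℤ) ^ e * m')
          ≤ #(S'.image fun x' => p ^ e' * x') := card_le_card hsub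
        _ ≤ #S' := card_image_le
        _ = p ^ e' * #((range (p ^ (k - e))).filter
              fun x' : ℕ => (p : ℤ) ^ (k - e) ∣ a * (x' : ℤ) ^ 2 - m') := by
            have hke : p ^ (k - e') = p ^ (k - e) * p ^ e' := by rw [← pow_add]; congr 1; omega
            rw [hS', hke, card_filter_range_mul _ _ _ hper]
        _ ≤ p ^ e' * 4 := Nat.mul_le_mul_left _ (card_filter_unitSq_le_four hp _ a hm'p)
        _ = 4 * p ^ (e / 2) := by rw [mul_comm]; congr 2; omega
    · -- `e` odd: no solutions
      have hempty : ((range (p ^ k)).filter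
          fun x : ℕ => (p : ℤ) ^ k ∣ a * (x : ℤ) ^ 2 - m) = ∅ := by
        refine filter_eq_empty_iff.mpr fun x _ hdx => hmax' ?_
        have h1 := pow_dvd_of_pow_dvd_sq hp (hsol x hdx)
        have h2 : p ^ (e + 1) ∣ x ^ 2 := by
          obtain ⟨r, hr⟩ := hodd
          have h3 : (e + 1) / 2 = r + 1 := by omega
          rw [h3] at h1
          have := pow_dvd_pow_of_dvd h1 2
          rwa [← pow_mul, show (r + 1) * 2 = e + 1 by omega] at this
        have h3 : (p : ℤ) ^ (e + 1) ∣ a * (x : ℤ) ^ 2 := by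
          have : ((p ^ (e + 1) : ℕ) : ℤ) ∣ ((x ^ 2 : ℕ) : ℤ) := Int.natCast_dvd_natCast.mpr h2
          push_cast at this
          exact this.mul_left a
        have h4 : (p : ℤ) ^ (e + 1) ∣ a * (x : ℤ) ^ 2 - m := (pow_dvd_pow _ (by omega)).trans hdx
        have := dvd_sub h3 h4
        rwa [sub_sub_cancel] at this
      rw [hempty, card_empty]; exact Nat.zero_le _

/-! ### `N(a, b; q)` -/

/-- `N(a, b; q)`: the number of pairs `(x, y) (mod q)` with `a x² ≡ b y² (mod q)` (FI (9.8)).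
[cite: FriedlanderIwaniecAnnals1998, (9.8)] -/
def quadCongrCount (q : ℕ) (a b : ℤ) : ℕ :=
  #(((range q) ×ˢ (range q)).filter fun xy : ℕ × ℕ => (q : ℤ) ∣ a * (xy.1 : ℤ) ^ 2 - b * (xy.2 : ℤ) ^ 2)

/-- `quadCongrCount` unfolded. [cite: FriedlanderIwaniecAnnals1998, (9.8)] -/
theorem quadCongrCount_def (q : ℕ) (a b : ℤ) : quadCongrCount q a b =
    #(((range q) ×ˢ (range q)).filter
      fun xy : ℕ × ℕ => (q : ℤ) ∣ a * (xy.1 : ℤ) ^ 2 - b * (xy.2 : ℤ) ^ 2) := rfl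

/-- The trivial bound `N(a, b; q) ≤ q²`. [folklore] -/
theorem quadCongrCount_le_sq (q : ℕ) (a b : ℤ) : quadCongrCount q a b ≤ q ^ 2 := by
  unfold quadCongrCount
  calc _ ≤ #((range q) ×ˢ (range q)) := card_le_card (filter_subset _ _)
    _ = q ^ 2 := by rw [card_product, card_range, sq]

/-- Fibring `N(a, b; q)` over `y`. [folklore] -/
theorem quadCongrCount_eq_sum (q : ℕ) (a b : ℤ) : quadCongrCount q a b =
    ∑ y ∈ range q, #((range q).filter fun x : ℕ => (q : ℤ) ∣ a * (x : ℤ) ^ 2 - b * (y : ℤ) ^ 2) := by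
  unfold quadCongrCount
  rw [card_filter, sum_product_right]
  refine sum_congr rfl fun y _ => ?_
  rw [card_filter]

/-- `(n, p^k) = p^{min(v_p(n), k)}`. [folklore] -/
theorem gcd_prime_pow_eq {p : ℕ} (hp : p.Prime) {n : ℕ} (hn : n ≠ 0) (k : ℕ) :
    Nat.gcd n (p ^ k) = p ^ min (padicValNat p n) k := by
  haveI := Fact.mk hp
  apply Nat.dvd_antisymm
  · obtain ⟨i, hik, hi⟩ := (Nat.dvd_prime_pow hp).mp (Nat.gcd_dvd_right n (p ^ k))
    rw [hi]
    refine pow_dvd_pow _ (le_min ?_ hik)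
    have : p ^ i ∣ n := hi ▸ Nat.gcd_dvd_left n (p ^ k)
    exact (padicValNat_dvd_iff_le hn).mp this
  · exact Nat.dvd_gcd ((padicValNat_dvd_iff_le hn).mpr (min_le_left _ _))
      (pow_dvd_pow _ (min_le_right _ _))

/-- `∑_{y < p^k} ∑_{j ≤ k, p^j ∣ y} p^j = (k+1) p^k`. [folklore] -/
theorem sum_range_powWeight_eq {p : ℕ} (hp : p.Prime) (k : ℕ) :
    ∑ y ∈ range (p ^ k), ∑ j ∈ range (k + 1), (if p ^ j ∣ y then p ^ j else 0) =
      (k + 1) * p ^ k := by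
  rw [sum_comm]
  calc ∑ j ∈ range (k + 1), ∑ y ∈ range (p ^ k), (if p ^ j ∣ y then p ^ j else 0)
      = ∑ j ∈ range (k + 1), p ^ j * #((range (p ^ k)).filter fun y => p ^ j ∣ y) := by
        refine sum_congr rfl fun j _ => ?_
        rw [← sum_filter, sum_const, smul_eq_mul, mul_comm]
    _ = ∑ j ∈ range (k + 1), p ^ k := by
        refine sum_congr rfl fun j hj => ?_
        have hjk : j ≤ k := Nat.lt_succ_iff.mp (mem_range.mp hj)
        rw [card_filter_range_dvd (pow_pos hp.pos _) (pow_dvd_pow _ hjk),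
          Nat.pow_div hjk hp.pos, ← pow_add]
        congr 1; omega
    _ = (k + 1) * p ^ k := by rw [sum_const, card_range, smul_eq_mul]

/-- The weight `∑_{j ≤ k, p^j ∣ y} p^j` dominates `p^{min(v_p(y), k)}` (`y ≠ 0`) and `p^k` (`y = 0`).
[folklore] -/
theorem pow_min_le_powWeight {p : ℕ} (hp : p.Prime) (k : ℕ) {y : ℕ} (hy : y ≠ 0) :
    p ^ min (padicValNat p y) k ≤ ∑ j ∈ range (k + 1), (if p ^ j ∣ y then p ^ j else 0) := by
  haveI := Fact.mk hp
  have hmem : min (padicValNat p y) k ∈ range (k + 1) := mem_range.mpr (by omega)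
  have hdvd : p ^ min (padicValNat p y) k ∣ y := (padicValNat_dvd_iff_le hy).mpr (min_le_left _ _)
  calc p ^ min (padicValNat p y) k
      = (if p ^ min (padicValNat p y) k ∣ y then p ^ min (padicValNat p y) k else 0) := by
        rw [if_pos hdvd]
    _ ≤ ∑ j ∈ range (k + 1), (if p ^ j ∣ y then p ^ j else 0) :=
        single_le_sum (f := fun j => if p ^ j ∣ y then p ^ j else 0) (fun _ _ => Nat.zero_le _) hmem

/-- `p^k ≤ ∑_{j ≤ k, p^j ∣ 0} p^j`. [folklore] -/
theorem pow_le_powWeight_zero (p k : ℕ) :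
    p ^ k ≤ ∑ j ∈ range (k + 1), (if p ^ j ∣ (0 : ℕ) then p ^ j else 0) := by
  have hmem : k ∈ range (k + 1) := mem_range.mpr (Nat.lt_succ_self k)
  calc p ^ k = (if p ^ k ∣ (0 : ℕ) then p ^ k else 0) := by rw [if_pos (dvd_zero _)]
    _ ≤ _ := single_le_sum (f := fun j => if p ^ j ∣ (0 : ℕ) then p ^ j else 0)
        (fun _ _ => Nat.zero_le _) hmem

/-- The fibre bound: for `a b ≠ 0` and any `y`,
`#{x mod p^k : a x² ≡ b y² (mod p^k)} ≤ 4 p^{min(v_p(a) + v_p(b), k)} · ∑_{j ≤ k, p^j ∣ y} p^j`.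
[folklore] -/
theorem card_fibre_le {p : ℕ} (hp : p.Prime) (k : ℕ) {a b : ℤ} (ha : a ≠ 0) (hb : b ≠ 0) (y : ℕ) :
    #((range (p ^ k)).filter fun x : ℕ => (p : ℤ) ^ k ∣ a * (x : ℤ) ^ 2 - b * (y : ℤ) ^ 2) ≤
      4 * p ^ min (padicValInt p a + padicValInt p b) k *
        ∑ j ∈ range (k + 1), (if p ^ j ∣ y then p ^ j else 0) := by
  haveI := Fact.mk hp
  have hpp : Prime (p : ℤ) := Nat.prime_iff_prime_int.mp hp
  have hp0 : (p : ℤ) ≠ 0 := by exact_mod_cast hp.ne_zero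
  have hp1 : 1 ≤ p := hp.one_lt.le
  set α := padicValInt p a with hα
  set β := padicValInt p b with hβ
  set F := ∑ j ∈ range (k + 1), (if p ^ j ∣ y then p ^ j else 0) with hF
  have hF1 : 1 ≤ F := by
    have hmem : 0 ∈ range (k + 1) := mem_range.mpr (Nat.succ_pos k)
    calc 1 = (if p ^ 0 ∣ y then p ^ 0 else 0) := by simp
      _ ≤ F := single_le_sum (f := fun j => if p ^ j ∣ y then p ^ j else 0)
          (fun _ _ => Nat.zero_le _) hmem
  -- the trivial case `α ≥ k`
  by_cases hαk : k ≤ α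
  · have hmin : min (α + β) k = k := min_eq_right (by omega)
    calc #((range (p ^ k)).filter fun x : ℕ => (p : ℤ) ^ k ∣ a * (x : ℤ) ^ 2 - b * (y : ℤ) ^ 2)
        ≤ #(range (p ^ k)) := card_le_card (filter_subset _ _)
      _ = 1 * p ^ k * 1 := by rw [card_range]; ring
      _ ≤ 4 * p ^ min (α + β) k * F := by
          rw [hmin]; gcongr; norm_num
  rw [not_le] at hαk
  -- `a = p^α a'` with `p ∤ a'`
  obtain ⟨a', ha'⟩ : (p : ℤ) ^ α ∣ a := padicValInt_dvd a
  have ha'p : ¬ (p : ℤ) ∣ a' := by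
    intro h
    have : (p : ℤ) ^ (α + 1) ∣ a := by rw [ha', pow_succ]; exact mul_dvd_mul_left _ h
    rw [padicValInt_dvd_iff (α + 1) a] at this
    rcases this with h0 | h1
    · exact ha h0
    · omega  -- α + 1 ≤ α impossible
  set c : ℤ := b * (y : ℤ) ^ 2 with hc
  by_cases hcα : (p : ℤ) ^ α ∣ c
  · obtain ⟨c', hc'⟩ := hcα
    -- reduce the congruence modulo `p^{k-α}`
    have hkα : (p : ℤ) ^ k = (p : ℤ) ^ α * (p : ℤ) ^ (k - α) := by
      rw [← pow_add]; congr 1; omega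
    have hset : ((range (p ^ k)).filter fun x : ℕ => (p : ℤ) ^ k ∣ a * (x : ℤ) ^ 2 - c) =
        (range (p ^ k)).filter fun x : ℕ => (p : ℤ) ^ (k - α) ∣ a' * (x : ℤ) ^ 2 - c' := by
      refine filter_congr fun x _ => ?_
      rw [hc', ha', hkα, show (p : ℤ) ^ α * a' * (x : ℤ) ^ 2 - (p : ℤ) ^ α * c' =
        (p : ℤ) ^ α * (a' * (x : ℤ) ^ 2 - c') by ring]
      exact mul_dvd_mul_iff_left (pow_ne_zero α hp0)
    have hper : ∀ x : ℕ, ((p : ℤ) ^ (k - α) ∣ a' * ((x + p ^ (k - α) : ℕ) : ℤ) ^ 2 - c') ↔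
        ((p : ℤ) ^ (k - α) ∣ a' * (x : ℤ) ^ 2 - c') := by
      intro x
      have : a' * ((x + p ^ (k - α) : ℕ) : ℤ) ^ 2 - c' =
          (a' * (x : ℤ) ^ 2 - c') + (p : ℤ) ^ (k - α) * (a' * (2 * x + p ^ (k - α))) := by
        push_cast; ring
      rw [this]
      constructor
      · intro h1
        have := dvd_sub h1 (dvd_mul_right ((p : ℤ) ^ (k - α)) (a' * (2 * x + p ^ (k - α))))
        rwa [add_sub_cancel_right] at this
      · intro h1; exact dvd_add h1 (dvd_mul_right _ _)
    -- the exponent `e`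
    obtain ⟨e, hek, hem, hemax, hebound⟩ : ∃ e : ℕ, e ≤ k - α ∧ (p : ℤ) ^ e ∣ c' ∧
        (e = k - α ∨ ¬ (p : ℤ) ^ (e + 1) ∣ c') ∧ (c' ≠ 0 → e ≤ padicValInt p c') := by
      by_cases hc0 : c' = 0
      · exact ⟨k - α, le_rfl, by rw [hc0]; exact dvd_zero _, Or.inl rfl, fun h => absurd hc0 h⟩
      · refine ⟨min (padicValInt p c') (k - α), min_le_right _ _, ?_, ?_, fun _ => min_le_left _ _⟩
        · exact (padicValInt_dvd_iff _ c').mpr (Or.inr (min_le_left _ _))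
        · by_cases hlt : padicValInt p c' < k - α
          · right
            rw [min_eq_left hlt.le, padicValInt_dvd_iff _ c', not_or, not_le]
            exact ⟨hc0, Nat.lt_succ_self _⟩
          · left; exact min_eq_right (by omega)
    have hcount : #((range (p ^ k)).filter fun x : ℕ => (p : ℤ) ^ k ∣ a * (x : ℤ) ^ 2 - c) ≤
        p ^ α * (4 * p ^ (e / 2)) := by
      rw [hset]
      have hk' : p ^ k = p ^ (k - α) * p ^ α := by rw [← pow_add]; congr 1; omega
      rw [hk', card_filter_range_mul _ _ _ hper]
      exact Nat.mul_le_mul_left _ (card_filter_sq_congr_le hp hek ha'p hem hemax)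
    -- compare the exponents
    have hexp : p ^ α * p ^ (e / 2) ≤ p ^ min (α + β) k * F := by
      rcases eq_or_ne y 0 with rfl | hy
      · -- `y = 0`: `c = 0`, `c' = 0`, `e ≤ k - α`, and `F ≥ p^k`
        have hFk : p ^ k ≤ F := by rw [hF]; exact pow_le_powWeight_zero p k
        calc p ^ α * p ^ (e / 2) = p ^ (α + e / 2) := (pow_add _ _ _).symm
          _ ≤ p ^ k := Nat.pow_le_pow_right hp1 (by omega)
          _ = 1 * p ^ k := (one_mul _).symm
          _ ≤ p ^ min (α + β) k * F :=
              Nat.mul_le_mul (Nat.one_le_pow _ _ hp.pos) hFk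
      · set v := padicValNat p y with hv
        have hFv : p ^ min v k ≤ F := by rw [hF]; exact pow_min_le_powWeight hp k hy
        -- valuation of `c = b y²` is `β + 2v`, and `c = p^α c'`
        have hc0 : c ≠ 0 := mul_ne_zero hb (pow_ne_zero 2 (by exact_mod_cast hy))
        have hc'0 : c' ≠ 0 := by
          intro h0; apply hc0; rw [hc', h0, mul_zero]
        have hvy : padicValInt p ((y : ℤ) ^ 2) = 2 * v := by
          rw [hv, padicValInt]
          rw [Int.natAbs_pow, Int.natAbs_natCast, padicValNat.pow]
        have hvc : padicValInt p c = β + 2 * v := by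
          rw [hc, padicValInt.mul hb (pow_ne_zero 2 (by exact_mod_cast hy)), hvy]
        have hvp : padicValInt p ((p : ℤ) ^ α) = α := by
          rw [padicValInt, Int.natAbs_pow, Int.natAbs_natCast]
          exact padicValNat.prime_pow α
        have hvc' : padicValInt p c = α + padicValInt p c' := by
          rw [hc', padicValInt.mul (pow_ne_zero α hp0) hc'0, hvp]
        have he1 : e + α ≤ β + 2 * v := by
          have := hebound hc'0; omega
        calc p ^ α * p ^ (e / 2) = p ^ (α + e / 2) := (pow_add _ _ _).symm
          _ ≤ p ^ (min (α + β) k + min v k) := Nat.pow_le_pow_right hp1 (by omega)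
          _ = p ^ min (α + β) k * p ^ min v k := pow_add _ _ _
          _ ≤ p ^ min (α + β) k * F := Nat.mul_le_mul_left _ hFv
    calc #((range (p ^ k)).filter fun x : ℕ => (p : ℤ) ^ k ∣ a * (x : ℤ) ^ 2 - c)
        ≤ p ^ α * (4 * p ^ (e / 2)) := hcount
      _ = 4 * (p ^ α * p ^ (e / 2)) := by ring
      _ ≤ 4 * (p ^ min (α + β) k * F) := Nat.mul_le_mul_left _ hexp
      _ = 4 * p ^ min (α + β) k * F := (mul_assoc _ _ _).symm
  · -- no solutions at all
    have hempty : ((range (p ^ k)).filter fun x : ℕ => (p : ℤ) ^ k ∣ a * (x : ℤ) ^ 2 - c) = ∅ := by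
      refine filter_eq_empty_iff.mpr fun x _ hdx => hcα ?_
      have h1 : (p : ℤ) ^ α ∣ a * (x : ℤ) ^ 2 := by rw [ha', mul_assoc]; exact dvd_mul_right _ _
      have h2 : (p : ℤ) ^ α ∣ a * (x : ℤ) ^ 2 - c := (pow_dvd_pow _ hαk.le).trans hdx
      have := dvd_sub h1 h2
      rwa [sub_sub_cancel] at this
    rw [hempty, card_empty]; exact Nat.zero_le _

/-- **Lemma 9.1 at a prime power (crude form).** For `a b ≠ 0`,
`N(a, b; p^k) ≤ 4 (k+1) p^k (ab, p^k)`. [cite: FriedlanderIwaniecAnnals1998, Lemma 9.1] -/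
theorem quadCongrCount_prime_pow_le {p : ℕ} (hp : p.Prime) (k : ℕ) {a b : ℤ} (ha : a ≠ 0)
    (hb : b ≠ 0) :
    quadCongrCount (p ^ k) a b ≤ 4 * (k + 1) * p ^ k * Nat.gcd (a * b).natAbs (p ^ k) := by
  haveI := Fact.mk hp
  have hgcd : Nat.gcd (a * b).natAbs (p ^ k) = p ^ min (padicValInt p a + padicValInt p b) k := by
    rw [gcd_prime_pow_eq hp (Int.natAbs_ne_zero.mpr (mul_ne_zero ha hb)), ← padicValInt.mul ha hb]
    rfl
  rw [hgcd, quadCongrCount_eq_sum]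
  push_cast
  calc ∑ y ∈ range (p ^ k),
        #((range (p ^ k)).filter fun x : ℕ => (p : ℤ) ^ k ∣ a * (x : ℤ) ^ 2 - b * (y : ℤ) ^ 2)
      ≤ ∑ y ∈ range (p ^ k), 4 * p ^ min (padicValInt p a + padicValInt p b) k *
          ∑ j ∈ range (k + 1), (if p ^ j ∣ y then p ^ j else 0) :=
        sum_le_sum fun y _ => card_fibre_le hp k ha hb y
    _ = 4 * p ^ min (padicValInt p a + padicValInt p b) k * ((k + 1) * p ^ k) := by
        rw [← mul_sum, sum_range_powWeight_eq hp k]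
    _ = 4 * (k + 1) * p ^ k * p ^ min (padicValInt p a + padicValInt p b) k := by ring

/-- Sub-multiplicativity of `N(a, b; ·)` on coprime moduli (injectivity half of the Chinese
remainder theorem). [cite: FriedlanderIwaniecAnnals1998, Lemma 9.1 ("By multiplicativity")] -/
theorem quadCongrCount_mul_le {m n : ℕ} (hm : 0 < m) (hn : 0 < n) (hmn : m.Coprime n) (a b : ℤ) :
    quadCongrCount (m * n) a b ≤ quadCongrCount m a b * quadCongrCount n a b := by
  unfold quadCongrCount
  rw [← card_product]
  refine card_le_card_of_injOn (fun xy => ((xy.1 % m, xy.2 % m), (xy.1 % n, xy.2 % n))) ?_ ?_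
  · intro xy hxy
    obtain ⟨hr, hdvd⟩ := mem_filter.mp (mem_coe.mp hxy)
    rw [mem_coe, mem_product]
    have key : ∀ q : ℕ, 0 < q → q ∣ m * n →
        (xy.1 % q, xy.2 % q) ∈ ((range q) ×ˢ (range q)).filter
          fun xy : ℕ × ℕ => (q : ℤ) ∣ a * (xy.1 : ℤ) ^ 2 - b * (xy.2 : ℤ) ^ 2 := by
      intro q hq hqmn
      refine mem_filter.mpr ⟨mem_product.mpr ⟨mem_range.mpr (Nat.mod_lt _ hq),
        mem_range.mpr (Nat.mod_lt _ hq)⟩, ?_⟩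
      have h1 : (q : ℤ) ∣ a * (xy.1 : ℤ) ^ 2 - b * (xy.2 : ℤ) ^ 2 :=
        (Int.natCast_dvd_natCast.mpr hqmn).trans (by exact_mod_cast hdvd)
      have hx : (((xy.1 % q : ℕ) : ℤ)) ≡ (xy.1 : ℤ) [ZMOD q] := by
        rw [Int.natCast_mod]; exact Int.mod_modEq _ _
      have hy : (((xy.2 % q : ℕ) : ℤ)) ≡ (xy.2 : ℤ) [ZMOD q] := by
        rw [Int.natCast_mod]; exact Int.mod_modEq _ _
      have h2 : a * ((xy.1 % q : ℕ) : ℤ) ^ 2 - b * ((xy.2 % q : ℕ) : ℤ) ^ 2 ≡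
          a * (xy.1 : ℤ) ^ 2 - b * (xy.2 : ℤ) ^ 2 [ZMOD q] :=
        ((hx.pow 2).mul_left a).sub ((hy.pow 2).mul_left b)
      exact Int.modEq_zero_iff_dvd.mp (h2.trans (Int.modEq_zero_iff_dvd.mpr h1))
    exact ⟨key m hm (Dvd.intro _ rfl), key n hn (Dvd.intro_left _ rfl)⟩
  · intro xy hxy xy' hxy' h
    obtain ⟨hr, -⟩ := mem_filter.mp (mem_coe.mp hxy)
    obtain ⟨hr', -⟩ := mem_filter.mp (mem_coe.mp hxy')
    rw [mem_product, mem_range, mem_range] at hr hr'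
    simp only [Prod.mk.injEq] at h
    obtain ⟨⟨h1m, h2m⟩, h1n, h2n⟩ := h
    have e1 : xy.1 ≡ xy'.1 [MOD m * n] := (Nat.modEq_and_modEq_iff_modEq_mul hmn).mp ⟨h1m, h1n⟩
    have e2 : xy.2 ≡ xy'.2 [MOD m * n] := (Nat.modEq_and_modEq_iff_modEq_mul hmn).mp ⟨h2m, h2n⟩
    exact Prod.ext (Nat.ModEq.eq_of_lt_of_lt e1 hr.1 hr'.1) (Nat.ModEq.eq_of_lt_of_lt e2 hr.2 hr'.2)

/-- **FI Lemma 9.1 (crude form).** For `q ≥ 1` and all integers `a, b`: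
`N(a, b; q) ≤ τ(q)³ · q · (ab, q)` (with `(0, q) = q`). The source has `([a, b], q) q τ(q)`.
[cite: FriedlanderIwaniecAnnals1998, Lemma 9.1] -/
theorem quadCongrCount_le {q : ℕ} (hq : 0 < q) (a b : ℤ) :
    quadCongrCount q a b ≤ #q.divisors ^ 3 * q * Nat.gcd (a * b).natAbs q := by
  have hτ : 1 ≤ #q.divisors := Finset.card_pos.mpr ⟨1, Nat.one_mem_divisors.mpr hq.ne'⟩
  by_cases hab : a * b = 0
  · -- `(0, q) = q` and the trivial bound `q²`
    rw [hab, Int.natAbs_zero, Nat.gcd_zero_left]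
    calc quadCongrCount q a b ≤ q ^ 2 := quadCongrCount_le_sq q a b
      _ = 1 * q * q := by ring
      _ ≤ #q.divisors ^ 3 * q * q := by gcongr; exact Nat.one_le_pow _ _ hτ
  have ha : a ≠ 0 := fun h => hab (by rw [h, zero_mul])
  have hb : b ≠ 0 := fun h => hab (by rw [h, mul_zero])
  clear hτ
  induction q using Nat.recOnPosPrimePosCoprime with
  | zero => exact absurd hq (lt_irrefl 0)
  | one =>
    calc quadCongrCount 1 a b ≤ 1 ^ 2 := quadCongrCount_le_sq 1 a b
      _ ≤ _ := by simp
  | prime_pow p k hp hk =>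
    calc quadCongrCount (p ^ k) a b ≤ 4 * (k + 1) * p ^ k * Nat.gcd (a * b).natAbs (p ^ k) :=
          quadCongrCount_prime_pow_le hp k ha hb
      _ ≤ (k + 1) ^ 3 * p ^ k * Nat.gcd (a * b).natAbs (p ^ k) := by
          gcongr
          calc 4 * (k + 1) ≤ (k + 1) ^ 2 * (k + 1) := by
                refine Nat.mul_le_mul_right _ ?_; nlinarith
            _ = (k + 1) ^ 3 := by ring
      _ = #(p ^ k).divisors ^ 3 * p ^ k * Nat.gcd (a * b).natAbs (p ^ k) := by
          rw [← ArithmeticFunction.sigma_zero_apply, ArithmeticFunction.sigma_zero_apply_prime_pow hp]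
  | coprime m n hm hn hmn ihm ihn =>
    have hm0 : 0 < m := by omega
    have hn0 : 0 < n := by omega
    calc quadCongrCount (m * n) a b ≤ quadCongrCount m a b * quadCongrCount n a b :=
          quadCongrCount_mul_le hm0 hn0 hmn a b
      _ ≤ (#m.divisors ^ 3 * m * Nat.gcd (a * b).natAbs m) *
            (#n.divisors ^ 3 * n * Nat.gcd (a * b).natAbs n) := Nat.mul_le_mul (ihm hm0) (ihn hn0)
      _ = #(m * n).divisors ^ 3 * (m * n) * Nat.gcd (a * b).natAbs (m * n) := by
          rw [Nat.Coprime.card_divisors_mul hmn, Nat.Coprime.gcd_mul _ hmn]; ring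

end Literature.NumberTheory.Sieve.FriedlanderIwaniecPrimes
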